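import Literature.NumberTheory.LFunctions.WeilExplicitArchTermProofs
import Literature.NumberTheory.LFunctions.WeilExplicitGL2
import Literature.Analysis.SpecialFunctions.DigammaLogBound
import Mathlib.Analysis.SpecificLimits.Normed
import Mathlib.MeasureTheory.Integral.ExpDecay
import HarnessLib

/-!
# The x-space form of the shifted archimedean term («Lemma X» of the GL₂ window certificates)

For a test function `h` (`C_c^∞`) and `κ > 0`,

  `(1/π) ∫ ĥ(1/2 + it) Re ψ(κ + it) dt = 2ψ(κ) h(0) + ∫₀^∞ (2h(0) − h(u) − h(−u)) e^{−κu}/(1 − e^{−u}) du`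

(`ψ = Γ′/Γ`, `ĥ = weilMellin h`; `e^{−κu}/(1 − e^{−u}) = e^{−(κ−1)u}/(e^u − 1)`).  For `κ = k/2` this is
the archimedean term of the Weil functional of a weight-`k` newform (`WeilExplicitGL2.lean`,
`weilQuadraticGL2`: `(1/π)∫ ĥ(½+it) Re ψ(k/2+it) dt`) in position space — the form in which the cell's
GL₂ window certificates (`EXTREMALS/GL2-ext/`, rh-explicit P-1) are computed: density comparison and
Galerkin of the continuous kernel `e^{−(k/2−1)u}/(e^u−1)`; for `k = 2` the constant is `2ψ(1) = −2γ`
and the density `1/(e^u − 1)` (Mestre 1986 §II.2).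

PROOF = Bombieri's computation (2000, §2 (2.5)–(2.8)) for the `ζ` kernel, as formalised in
`WeilExplicitArchTermProofs.lean`, with `w = s/2` replaced by `w = s + (κ − 1/2) = κ + iy`
(`s = 1/2 + iy`): (i) symmetrise, `∫ ĥ(s)·2Re ψ(w) = ∫ K̂(s) ψ(w)`, `K = h + h(−·)` (`weilSymm`);
(ii) integrate the series `ψ(w) + γ = Σₙ (1/(n+1) − 1/(w+n))` (Andrews–Askey–Roy (1.2.13)) term by
term (dominated convergence, `K̂` decays like `(1+y²)^{-2}`); (iii) each term is polar:
`∫ K̂(s)/(w+n) dy = 2π ∫₀^∞ K(x) e^{−(n+κ)x} dx` (`integral_weilMellin_vertical_div_sub`), `∫ K̂ = 2πK(0)`;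
(iv) on the x-side `e^{−κu}/(1 − e^{−u}) = Σₙ e^{−(n+κ)u}` and dominated convergence
(`K(0) − K(u) = O(u)`); (v) the two series differ by `K(0) Σₙ (1/(n+1) − 1/(n+κ)) = K(0)(ψ(κ) + γ)`.
No named fact. [References: Bombieri, Rend. Lincei (9) 11 (2000) §2; Andrews–Askey–Roy Thm 1.2.5;
Iwaniec–Kowalski (5.45)/(5.86); Mestre, Compositio 58 (1986) §II.2.]
-/

noncomputable section

open Complex Filter Set MeasureTheory
open scoped Real Topology

namespace Literature.NumberTheory.LFunctions

variable {h k : ℝ → ℂ}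

/-! ### (ii) The digamma series under the integral sign, shifted argument `w = κ + iy` -/

/-- Term-by-term integration of `ψ(w) + γ = Σₙ (1/(n+1) − 1/(w+n))`, `w = κ + iy`, `κ > 0`, against
`k̂(1/2 + iy)` (dominated convergence; terms `≤ ‖w−1‖‖k̂‖/(min(κ,1)(n+1)²)`). [cite: Bombieri2000Weil, §2 eq. (2.5) (shifted Gamma factor)] -/
theorem hasSum_integral_weilMellin_mul_digammaSeries_shift (hk : IsWeilTest k) {κ : ℝ} (hκ : 0 < κ) :
    HasSum (fun n : ℕ ↦ ∫ y : ℝ, weilMellin k (((1 / 2 : ℝ) : ℂ) + y * I) *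
        (1 / ((n : ℂ) + 1) - 1 / (((κ : ℂ) + y * I) + n)))
      (∫ y : ℝ, weilMellin k (((1 / 2 : ℝ) : ℂ) + y * I) *
        (digamma ((κ : ℂ) + y * I) + Real.eulerMascheroniConstant)) := by
  set m : ℝ := min κ 1 with hm
  have hm0 : 0 < m := lt_min hκ one_pos
  have hw : ∀ y : ℝ, 0 < ((κ : ℂ) + y * I).re := fun y ↦ by simpa using hκ
  have hwm : ∀ y : ℝ, min ((κ : ℂ) + y * I).re 1 = m := fun y ↦ by simp [hm]
  have hne : ∀ (y : ℝ) (n : ℕ), (κ : ℂ) + y * I + n ≠ 0 := by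
    intro y n h0
    have h1 := congrArg Complex.re h0
    simp at h1
    have hn : (0 : ℝ) ≤ n := n.cast_nonneg
    linarith
  have hS : Summable fun n : ℕ ↦ 1 / ((n : ℝ) + 1) ^ 2 := by
    have h := (Real.summable_one_div_nat_pow.2 one_lt_two)
    exact_mod_cast (summable_nat_add_iff 1).2 h
  refine hasSum_integral_of_dominated_convergence
    (fun (n : ℕ) (y : ℝ) ↦ m⁻¹ * ‖(κ : ℂ) + y * I - 1‖ *
      ‖weilMellin k (((1 / 2 : ℝ) : ℂ) + y * I)‖ * (1 / ((n : ℝ) + 1) ^ 2))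
    (fun n ↦ ?_) (fun n ↦ Eventually.of_forall fun y ↦ ?_) (Eventually.of_forall fun y ↦ ?_) ?_
    (Eventually.of_forall fun y ↦ ?_)
  · exact ((continuous_weilMellin_vertical hk.1.continuous hk.2 _).mul
      (continuous_const.sub (continuous_const.div (by fun_prop) fun y ↦ hne y n))).aestronglyMeasurable
  · rw [norm_mul]
    have h := Literature.Analysis.SpecialFunctions.Complex.norm_one_div_sub_one_div_le (hw y) n
    rw [hwm y] at h
    have hk0 := norm_nonneg (weilMellin k (((1 / 2 : ℝ) : ℂ) + y * I))
    calc ‖weilMellin k (((1 / 2 : ℝ) : ℂ) + y * I)‖ * ‖1 / ((n : ℂ) + 1) - 1 / ((κ : ℂ) + y * I + n)‖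
        ≤ ‖weilMellin k (((1 / 2 : ℝ) : ℂ) + y * I)‖ *
          (‖(κ : ℂ) + y * I - 1‖ / (m * ((n : ℝ) + 1) ^ 2)) := mul_le_mul_of_nonneg_left h hk0
      _ = m⁻¹ * ‖(κ : ℂ) + y * I - 1‖ * ‖weilMellin k (((1 / 2 : ℝ) : ℂ) + y * I)‖ *
          (1 / ((n : ℝ) + 1) ^ 2) := by
          have : (0 : ℝ) < ((n : ℝ) + 1) ^ 2 := by positivity
          field_simp
  · exact hS.mul_left _
  · simp_rw [tsum_mul_left]
    refine Integrable.mul_const ?_ _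
    have hF : Continuous fun y : ℝ ↦ ((m⁻¹ : ℝ) : ℂ) * ((κ : ℂ) + y * I - 1) := by fun_prop
    have hI := integrable_mul_weilMellin_vertical_of_norm_le_linear hk (1 / 2) hF
      (C := m⁻¹ * (|κ - 1| + 1)) fun y ↦ ?_
    · refine hI.norm.congr (Eventually.of_forall fun y ↦ ?_)
      simp only [norm_mul, Complex.norm_real, Real.norm_eq_abs, abs_of_pos (inv_pos.2 hm0)]
    · rw [norm_mul, Complex.norm_real, Real.norm_eq_abs, abs_of_pos (inv_pos.2 hm0)]
      have hre : ((κ : ℂ) + y * I - 1).re = κ - 1 := by simp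
      have him : ((κ : ℂ) + y * I - 1).im = y := by simp
      have h1 : ‖(κ : ℂ) + y * I - 1‖ ≤ (|κ - 1| + 1) * (1 + |y|) := by
        refine (Complex.norm_le_abs_re_add_abs_im _).trans ?_
        rw [hre, him]
        nlinarith [abs_nonneg (κ - 1), abs_nonneg y]
      calc m⁻¹ * ‖(κ : ℂ) + y * I - 1‖ ≤ m⁻¹ * ((|κ - 1| + 1) * (1 + |y|)) :=
            mul_le_mul_of_nonneg_left h1 (inv_pos.2 hm0).le
        _ = m⁻¹ * (|κ - 1| + 1) * (1 + |y|) := by ring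
  · exact (Literature.Analysis.SpecialFunctions.Complex.hasSum_one_div_sub_one_div_digamma
      (hw y)).mul_left _

/-! ### (iii) The terms are polar integrals -/

/-- For `w = κ + iy = s − a` with `a = 1/2 − κ − n` (`s = 1/2 + iy`):
`∫ k̂(s)(1/(n+1) − 1/(w+n)) dy = 2π k(0)/(n+1) − 2π ∫₀^∞ k(x) e^{−(n+κ)x} dx`.
[cite: Bombieri2000Weil, §2 eq. (2.6) (polar integral, shifted)] -/
theorem integral_weilMellin_mul_digammaSeriesTerm_shift (hk : IsWeilTest k) {κ : ℝ} (hκ : 0 < κ)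
    (n : ℕ) :
    ∫ y : ℝ, weilMellin k (((1 / 2 : ℝ) : ℂ) + y * I) *
        (1 / ((n : ℂ) + 1) - 1 / (((κ : ℂ) + y * I) + n)) =
      2 * π * k 0 / ((n : ℂ) + 1) -
        2 * π * ∫ x in Ioi (0 : ℝ), k x * cexp (-(((n : ℂ) + κ) * x)) := by
  have h1 : Integrable fun y : ℝ ↦ weilMellin k (((1 / 2 : ℝ) : ℂ) + y * I) :=
    integrable_weilMellin_vertical hk _
  set a : ℂ := ((1 / 2 : ℝ) : ℂ) - κ - n with ha
  have hn : (0 : ℝ) ≤ n := n.cast_nonneg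
  have hre : a.re < (1 / 2 : ℝ) := by simp [ha]; linarith
  have h2 := integral_weilMellin_vertical_div_sub hk (c := 1 / 2) (a := a) hre
  have h2i := integrable_weilMellin_vertical_div_sub hk (c := 1 / 2) (a := a) hre.ne
  have e : ∀ y : ℝ, weilMellin k (((1 / 2 : ℝ) : ℂ) + y * I) *
      (1 / ((n : ℂ) + 1) - 1 / (((κ : ℂ) + y * I) + n)) =
      1 / ((n : ℂ) + 1) * weilMellin k (((1 / 2 : ℝ) : ℂ) + y * I) -
        weilMellin k (((1 / 2 : ℝ) : ℂ) + y * I) / (((1 / 2 : ℝ) : ℂ) + y * I - a) := by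
    intro y
    have key : ((κ : ℂ) + y * I) + n = ((1 / 2 : ℝ) : ℂ) + y * I - a := by
      simp only [ha]; ring
    rw [key]
    ring
  simp_rw [e]
  rw [integral_sub (h1.const_mul _) h2i, integral_const_mul, integral_weilMellin_vertical hk, h2]
  have e2 : ∀ x : ℝ, cexp ((a - 1 / 2) * x) = cexp (-(((n : ℂ) + κ) * x)) := by
    intro x; congr 1; simp only [ha]; push_cast; ring
  simp_rw [e2]
  ring

/-- Integrability of `y ↦ ψ(κ + iy) k̂(1/2 + iy)` (logarithmic growth of `ψ` against the decay of `k̂`).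
[cite: Bombieri2000Weil, §2 (convergence of the Gamma-factor integral)] -/
theorem integrable_digamma_shift_mul_weilMellin (hk : IsWeilTest k) {κ : ℝ} (hκ : 0 < κ) :
    Integrable fun y : ℝ ↦ weilMellin k (((1 / 2 : ℝ) : ℂ) + y * I) * digamma ((κ : ℂ) + y * I) := by
  obtain ⟨C, hC⟩ := Literature.Analysis.SpecialFunctions.Complex.exists_norm_digamma_vertical_le hκ
  have hFc : Continuous fun y : ℝ ↦ digamma ((κ : ℂ) + y * I) := by
    refine Literature.Analysis.SpecialFunctions.Complex.continuousOn_digamma.comp_continuous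
      (by fun_prop) fun y ↦ ?_
    simpa using hκ
  have hI := integrable_mul_weilMellin_vertical_of_norm_le_log hk (1 / 2) hFc hC
  exact hI.congr (Eventually.of_forall fun y ↦ by ring)

/-- **The shifted archimedean integral as a series**: for a test function `k` and `κ > 0`,
`Σₙ (2π k(0)/(n+1) − 2π ∫₀^∞ k(x) e^{−(n+κ)x} dx) = ∫ k̂(1/2+iy) ψ(κ+iy) dy + 2πγ k(0)`.
[cite: Bombieri2000Weil, §2 eq. (2.7) (shifted)] -/
theorem hasSum_archIntegral_shift (hk : IsWeilTest k) {κ : ℝ} (hκ : 0 < κ) :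
    HasSum (fun n : ℕ ↦ 2 * π * k 0 / ((n : ℂ) + 1) -
        2 * π * ∫ x in Ioi (0 : ℝ), k x * cexp (-(((n : ℂ) + κ) * x)))
      ((∫ y : ℝ, weilMellin k (((1 / 2 : ℝ) : ℂ) + y * I) * digamma ((κ : ℂ) + y * I)) +
        2 * π * Real.eulerMascheroniConstant * k 0) := by
  have hA := hasSum_integral_weilMellin_mul_digammaSeries_shift hk hκ
  simp_rw [integral_weilMellin_mul_digammaSeriesTerm_shift hk hκ] at hA
  have hIψ := integrable_digamma_shift_mul_weilMellin hk hκ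
  have hI1 : Integrable fun y : ℝ ↦ weilMellin k (((1 / 2 : ℝ) : ℂ) + y * I) :=
    integrable_weilMellin_vertical hk _
  have hsplit : (∫ y : ℝ, weilMellin k (((1 / 2 : ℝ) : ℂ) + y * I) *
      (digamma ((κ : ℂ) + y * I) + Real.eulerMascheroniConstant)) =
      (∫ y : ℝ, weilMellin k (((1 / 2 : ℝ) : ℂ) + y * I) * digamma ((κ : ℂ) + y * I)) +
        2 * π * Real.eulerMascheroniConstant * k 0 := by
    have e : (fun y : ℝ ↦ weilMellin k (((1 / 2 : ℝ) : ℂ) + y * I) *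
        (digamma ((κ : ℂ) + y * I) + Real.eulerMascheroniConstant)) =
        fun y : ℝ ↦ weilMellin k (((1 / 2 : ℝ) : ℂ) + y * I) * digamma ((κ : ℂ) + y * I) +
          weilMellin k (((1 / 2 : ℝ) : ℂ) + y * I) * Real.eulerMascheroniConstant := by
      funext y; ring
    rw [e, integral_add hIψ (hI1.mul_const _), integral_mul_const, integral_weilMellin_vertical hk]
    ring
  rwa [hsplit] at hA

/-! ### (iv) The x-side: `e^{−κu}/(1 − e^{−u}) = Σₙ e^{−(n+κ)u}` -/

/-- `‖k(x) − k(0)‖ ≤ M x` on `[0, 1]` for a test function (mean value theorem). [folklore] -/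
private theorem exists_norm_sub_apply_zero_le_mul (hk : IsWeilTest k) :
    ∃ M : ℝ, 0 ≤ M ∧ ∀ x ∈ Icc (0 : ℝ) 1, ‖k x - k 0‖ ≤ M * x := by
  have hcont : Continuous (deriv k) := hk.1.continuous_deriv (by simp)
  obtain ⟨M, hM⟩ := (isCompact_Icc (a := (0 : ℝ)) (b := 1)).exists_bound_of_continuousOn
    hcont.continuousOn
  have hM0 : 0 ≤ M := (norm_nonneg _).trans (hM 0 (left_mem_Icc.2 zero_le_one))
  refine ⟨M, hM0, fun x hx ↦ ?_⟩
  have hdiff : ∀ y ∈ Icc (0 : ℝ) 1, DifferentiableAt ℝ k y := fun y _ ↦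
    (hk.1.differentiable (by simp)) y
  have hmv := (convex_Icc (0 : ℝ) 1).norm_image_sub_le_of_norm_deriv_le hdiff
    (fun y hy ↦ hM y hy) (left_mem_Icc.2 zero_le_one) hx
  rw [sub_zero, Real.norm_eq_abs, abs_of_nonneg hx.1] at hmv
  exact hmv

/-- `1 − e^{−x} ≥ x/2` for `0 ≤ x ≤ 1` and `≥ 1/2` for `x ≥ 1`; packaged as
`min x 1 ≤ 2(1 − e^{−x})` for `x ≥ 0`. [folklore] -/
private theorem min_le_two_mul_one_sub_exp_neg {x : ℝ} (hx : 0 ≤ x) : min x 1 ≤ 2 * (1 - Real.exp (-x)) := by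
  have h1 : Real.exp (-x) ≤ 1 / (1 + x) := by
    rw [le_div_iff₀ (by linarith), Real.exp_neg]
    have := Real.add_one_le_exp x
    have hpos := Real.exp_pos x
    calc (Real.exp x)⁻¹ * (1 + x) ≤ (Real.exp x)⁻¹ * Real.exp x := by
          gcongr; linarith
      _ = 1 := inv_mul_cancel₀ hpos.ne'
  rcases le_or_gt x 1 with hx1 | hx1
  · rw [min_eq_left hx1]
    have : 1 - Real.exp (-x) ≥ x / (1 + x) := by
      have hpos : 0 < 1 + x := by linarith
      rw [ge_iff_le, div_le_iff₀ hpos]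
      nlinarith [h1, mul_le_mul_of_nonneg_right h1 hpos.le, div_mul_cancel₀ (1 : ℝ) hpos.ne']
    have h3 : x / 2 ≤ x / (1 + x) := by
      rw [div_le_div_iff₀ (by norm_num) (by linarith)]; nlinarith
    linarith
  · rw [min_eq_right hx1.le]
    have : Real.exp (-x) ≤ 1 / 2 := h1.trans (by
      rw [div_le_div_iff₀ (by linarith) (by norm_num)]; linarith)
    linarith

/-- The x-side majorant is integrable: `‖k(0) − k(u)‖ e^{−κu}/(1 − e^{−u}) ≤ C e^{−κu}` on `(0,∞)`.
[folklore] -/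
private theorem integrableOn_xMajorant (hk : IsWeilTest k) {κ : ℝ} (hκ : 0 < κ) :
    IntegrableOn (fun u : ℝ ↦ ‖k 0 - k u‖ * (Real.exp (-(κ * u)) / (1 - Real.exp (-u)))) (Ioi 0) := by
  obtain ⟨M, hM0, hM⟩ := exists_norm_sub_apply_zero_le_mul hk
  obtain ⟨K, hK⟩ := hk.1.continuous.bounded_above_of_compact_support hk.2
  have hK0 : 0 ≤ K := (norm_nonneg _).trans (hK 0)
  have hkc : Continuous k := hk.1.continuous
  set C : ℝ := 4 * M + 8 * K with hC
  refine Integrable.mono' ((exp_neg_integrableOn_Ioi 0 hκ).const_mul C) ?_ ?_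
  · refine ((by fun_prop : Continuous fun u : ℝ ↦ ‖k 0 - k u‖).measurable.mul
      (Measurable.div (by fun_prop : Continuous fun u : ℝ ↦ Real.exp (-(κ * u))).measurable
        (by fun_prop : Continuous fun u : ℝ ↦ 1 - Real.exp (-u)).measurable)).aestronglyMeasurable
  · refine (ae_restrict_iff' measurableSet_Ioi).2 (Eventually.of_forall fun u (hu : 0 < u) ↦ ?_)
    have hden : 0 < 1 - Real.exp (-u) := by
      have : Real.exp (-u) < 1 := Real.exp_lt_one_iff.2 (by linarith); linarith
    have hmin := min_le_two_mul_one_sub_exp_neg hu.le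
    have hE : 0 < Real.exp (-(κ * u)) := Real.exp_pos _
    rw [Real.norm_eq_abs, abs_of_nonneg (by positivity)]
    have hkey : ‖k 0 - k u‖ ≤ C / 2 * (1 - Real.exp (-u)) := by
      rcases le_or_gt u 1 with hu1 | hu1
      · have h1 : ‖k 0 - k u‖ ≤ M * u := by rw [norm_sub_rev]; exact hM u ⟨hu.le, hu1⟩
        rw [min_eq_left hu1] at hmin
        calc ‖k 0 - k u‖ ≤ M * u := h1
          _ ≤ M * (2 * (1 - Real.exp (-u))) := by gcongr
          _ ≤ C / 2 * (1 - Real.exp (-u)) := by rw [hC]; nlinarith [hden]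
      · have h1 : ‖k 0 - k u‖ ≤ 2 * K := (norm_sub_le _ _).trans (by linarith [hK 0, hK u])
        rw [min_eq_right hu1.le] at hmin
        calc ‖k 0 - k u‖ ≤ 2 * K := h1
          _ ≤ 2 * K * (2 * (1 - Real.exp (-u))) := le_mul_of_one_le_right (by positivity) hmin
          _ ≤ C / 2 * (1 - Real.exp (-u)) := by rw [hC]; nlinarith [hden]
    calc ‖k 0 - k u‖ * (Real.exp (-(κ * u)) / (1 - Real.exp (-u)))
        ≤ C / 2 * (1 - Real.exp (-u)) * (Real.exp (-(κ * u)) / (1 - Real.exp (-u))) :=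
          mul_le_mul_of_nonneg_right hkey (by positivity)
      _ = C / 2 * Real.exp (-(κ * u)) := by field_simp
      _ ≤ C * Real.exp (-κ * u) := by
          rw [neg_mul]; nlinarith [hE, show (0:ℝ) ≤ C from by rw [hC]; positivity]

/-- **Expansion of the x-side integral**: for a test function `k` and `κ > 0`,
`Σₙ ∫₀^∞ (k(0) − k(u)) e^{−(n+κ)u} du = ∫₀^∞ (k(0) − k(u)) e^{−κu}/(1 − e^{−u}) du`.
[cite: Bombieri2000Weil, §2 eq. (2.8) (geometric expansion of the kernel, shifted)] -/
theorem hasSum_integral_xTerms (hk : IsWeilTest k) {κ : ℝ} (hκ : 0 < κ) :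
    HasSum (fun n : ℕ ↦ ∫ u in Ioi (0 : ℝ), (k 0 - k u) * cexp (-(((n : ℂ) + κ) * u)))
      (∫ u in Ioi (0 : ℝ), (k 0 - k u) * (cexp (-((κ : ℂ) * u)) / (1 - cexp (-(u : ℂ))))) := by
  have hkc : Continuous k := hk.1.continuous
  have hpowC : ∀ (n : ℕ) (u : ℝ), cexp (-(((n : ℂ) + κ) * u)) = cexp (-((κ : ℂ) * u)) * cexp (-(u : ℂ)) ^ n := by
    intro n u; rw [← Complex.exp_nat_mul, ← Complex.exp_add]; congr 1; ring
  have hnorm : ∀ (n : ℕ) (u : ℝ), ‖cexp (-(((n : ℂ) + κ) * u))‖ = Real.exp (-(κ * u)) * Real.exp (-u) ^ n := by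
    intro n u
    rw [hpowC, norm_mul, norm_pow, Complex.norm_exp, Complex.norm_exp]
    simp
  refine hasSum_integral_of_dominated_convergence
    (fun (n : ℕ) (u : ℝ) ↦ ‖k 0 - k u‖ * (Real.exp (-(κ * u)) * Real.exp (-u) ^ n))
    (fun n ↦ ?_) (fun n ↦ Eventually.of_forall fun u ↦ ?_) ?_ ?_ ?_
  · exact (by fun_prop : Continuous fun u : ℝ ↦ (k 0 - k u) * cexp (-(((n : ℂ) + κ) * u))).aestronglyMeasurable
  · rw [norm_mul, hnorm]
  · refine (ae_restrict_iff' measurableSet_Ioi).2 (Eventually.of_forall fun u (hu : 0 < u) ↦ ?_)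
    have h0 : 0 ≤ Real.exp (-u) := (Real.exp_pos _).le
    have h1 : Real.exp (-u) < 1 := Real.exp_lt_one_iff.2 (by linarith)
    have e : (fun n : ℕ ↦ ‖k 0 - k u‖ * (Real.exp (-(κ * u)) * Real.exp (-u) ^ n)) =
        fun n : ℕ ↦ ‖k 0 - k u‖ * Real.exp (-(κ * u)) * Real.exp (-u) ^ n := by
      funext n; ring
    rw [e]
    exact (summable_geometric_of_lt_one h0 h1).mul_left _
  · refine ((integrableOn_xMajorant hk hκ).congr_fun (fun u (hu : 0 < u) ↦ ?_)
      measurableSet_Ioi).integrable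
    have h0 : 0 ≤ Real.exp (-u) := (Real.exp_pos _).le
    have h1 : Real.exp (-u) < 1 := Real.exp_lt_one_iff.2 (by linarith)
    have e : (fun n : ℕ ↦ ‖k 0 - k u‖ * (Real.exp (-(κ * u)) * Real.exp (-u) ^ n)) =
        fun n : ℕ ↦ ‖k 0 - k u‖ * Real.exp (-(κ * u)) * Real.exp (-u) ^ n := by
      funext n; ring
    show ‖k 0 - k u‖ * (Real.exp (-(κ * u)) / (1 - Real.exp (-u))) =
      ∑' n : ℕ, ‖k 0 - k u‖ * (Real.exp (-(κ * u)) * Real.exp (-u) ^ n)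
    rw [e, tsum_mul_left, tsum_geometric_of_lt_one h0 h1]
    field_simp
  · refine (ae_restrict_iff' measurableSet_Ioi).2 (Eventually.of_forall fun u (hu : 0 < u) ↦ ?_)
    have hr : ‖cexp (-(u : ℂ))‖ < 1 := by
      rw [Complex.norm_exp]; simp; exact hu
    have hgeo := (hasSum_geometric_of_norm_lt_one hr).mul_left ((k 0 - k u) * cexp (-((κ : ℂ) * u)))
    have hne : (1 : ℂ) - cexp (-(u : ℂ)) ≠ 0 := by
      intro h0
      have : ‖cexp (-(u : ℂ))‖ = 1 := by rw [← sub_eq_zero.1 h0]; simp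
      linarith
    have ef : (fun n : ℕ ↦ (k 0 - k u) * cexp (-(((n : ℂ) + κ) * u))) =
        fun n : ℕ ↦ (k 0 - k u) * cexp (-((κ : ℂ) * u)) * cexp (-(u : ℂ)) ^ n := by
      funext n; rw [hpowC]; ring
    rw [ef, div_eq_mul_inv, ← mul_assoc]
    exact hgeo

/-- The terms of the x-side expansion: `∫₀^∞ (k(0) − k(u)) e^{−(n+κ)u} du = k(0)/(n+κ) − ∫₀^∞ k(u) e^{−(n+κ)u} du`.
[folklore] -/
private theorem integral_xTerm (hk : IsWeilTest k) {κ : ℝ} (hκ : 0 < κ) (n : ℕ) :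
    ∫ u in Ioi (0 : ℝ), (k 0 - k u) * cexp (-(((n : ℂ) + κ) * u)) =
      k 0 / ((n : ℂ) + κ) - ∫ u in Ioi (0 : ℝ), k u * cexp (-(((n : ℂ) + κ) * u)) := by
  have hn : (0 : ℝ) ≤ n := n.cast_nonneg
  have ha : (-((n : ℂ) + κ)).re < 0 := by simp; linarith
  have e : ∀ u : ℝ, cexp (-(((n : ℂ) + κ) * u)) = cexp (-((n : ℂ) + κ) * u) := by
    intro u; congr 1; ring
  simp_rw [e]
  have hi1 : IntegrableOn (fun u : ℝ ↦ k 0 * cexp (-((n : ℂ) + κ) * u)) (Ioi 0) :=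
    (integrableOn_exp_mul_complex_Ioi ha 0).const_mul _
  have hi2 : IntegrableOn (fun u : ℝ ↦ k u * cexp (-((n : ℂ) + κ) * u)) (Ioi 0) :=
    ((hk.1.continuous.mul (by fun_prop)).integrable_of_hasCompactSupport hk.2.mul_right).integrableOn
  have esub : (fun u : ℝ ↦ (k 0 - k u) * cexp (-((n : ℂ) + κ) * u)) =
      fun u : ℝ ↦ k 0 * cexp (-((n : ℂ) + κ) * u) - k u * cexp (-((n : ℂ) + κ) * u) := by
    funext u; ring
  rw [esub, integral_sub hi1 hi2, integral_const_mul, integral_exp_mul_complex_Ioi ha 0]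
  have hne : (n : ℂ) + κ ≠ 0 := by
    intro h0; have := congrArg Complex.re h0; simp at this; linarith
  congr 1
  rw [Complex.ofReal_zero, mul_zero, Complex.exp_zero]
  field_simp

/-! ### (i) Symmetrisation and (v) assembly -/

/-- Symmetrisation: `∫ ĥ(1/2+iy)·2Re ψ(κ+iy) dy = ∫ K̂(1/2+iy) ψ(κ+iy) dy`, `K = weilSymm h`
(`K̂(s) = ĥ(s) + ĥ(1−s)`, `y ↦ −y`, `ψ(κ − iy) = conj ψ(κ + iy)`). [cite: Bombieri2000Weil, §2 (the Gamma factor contributes the archimedean term)] -/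
theorem integral_weilMellin_mul_two_re_digamma_shift (hh : IsWeilTest h) {κ : ℝ} (hκ : 0 < κ) :
    (∫ y : ℝ, weilMellin h (((1 / 2 : ℝ) : ℂ) + y * I) * (2 * ((digamma ((κ : ℂ) + y * I)).re : ℂ))) =
      ∫ y : ℝ, weilMellin (weilSymm h) (((1 / 2 : ℝ) : ℂ) + y * I) * digamma ((κ : ℂ) + y * I) := by
  set c : ℝ := 1 / 2 with hc
  have hrefl : ∀ y : ℝ, 1 - ((c : ℂ) + y * I) = (c : ℂ) + ((-y : ℝ) : ℂ) * I := by
    intro y; simp only [hc]; push_cast; ring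
  set A : ℝ → ℂ := fun y ↦ weilMellin h (c + y * I) * digamma ((κ : ℂ) + y * I) with hA
  set B : ℝ → ℂ := fun y ↦ weilMellin h (c + y * I) * digamma ((κ : ℂ) + ((-y : ℝ) : ℂ) * I) with hB
  have hAi : Integrable A := integrable_digamma_shift_mul_weilMellin hh hκ
  have hBi : Integrable B := by
    have hneg : Integrable (fun y : ℝ ↦ A (-y)) := hAi.comp_neg
    -- `B` is not `A ∘ neg`; prove directly as for `A` with the conjugate factor
    obtain ⟨C, hC⟩ := Literature.Analysis.SpecialFunctions.Complex.exists_norm_digamma_vertical_le hκ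
    have hFc : Continuous fun y : ℝ ↦ digamma ((κ : ℂ) + ((-y : ℝ) : ℂ) * I) := by
      refine Literature.Analysis.SpecialFunctions.Complex.continuousOn_digamma.comp_continuous
        (by fun_prop) fun y ↦ ?_
      simpa using hκ
    have hFb : ∀ y : ℝ, ‖digamma ((κ : ℂ) + ((-y : ℝ) : ℂ) * I)‖ ≤ C + Real.log (1 + |y|) := by
      intro y; have := hC (-y); rwa [abs_neg] at this
    have hI := integrable_mul_weilMellin_vertical_of_norm_le_log hh c hFc hFb
    exact hI.congr (Eventually.of_forall fun y ↦ by simp only [hB]; ring)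
  have hsplit : (fun y : ℝ ↦ weilMellin (weilSymm h) ((c : ℂ) + y * I) * digamma ((κ : ℂ) + y * I)) =
      fun y : ℝ ↦ A y + B (-y) := by
    funext y
    rw [weilMellin_weilSymm hh, hrefl y]
    simp only [hA, hB, neg_neg]
    push_cast
    ring
  rw [hsplit, integral_add hAi hBi.comp_neg, integral_neg_eq_self B volume, ← integral_add hAi hBi]
  congr 1 with y
  have hw : (κ : ℂ) + ((-y : ℝ) : ℂ) * I = (starRingEnd ℂ) ((κ : ℂ) + y * I) := by
    simp only [map_add, map_mul, Complex.conj_ofReal, Complex.conj_I]; push_cast; ring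
  simp only [hA, hB]
  rw [hw, Literature.NumberTheory.LFunctions.digamma_conj, ← mul_add, Complex.add_conj]
  push_cast
  ring

/-- The x-space kernel in closed form: `e^{−κu}/(1 − e^{−u}) = e^{−(κ−1)u}/(e^u − 1)` for `u ≠ 0`
(real; for `κ = 1/4`, doubled variable, this is Bombieri's `1/(2 sinh x)`). [cite: Bombieri2000Weil, §2 eq. (2.8) (the kernel, shifted)] -/
theorem exp_neg_mul_div_one_sub_exp_neg {κ u : ℝ} (hu : u ≠ 0) :
    Real.exp (-(κ * u)) / (1 - Real.exp (-u)) = Real.exp (-((κ - 1) * u)) / (Real.exp u - 1) := by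
  have h1 : Real.exp u ≠ 0 := (Real.exp_pos u).ne'
  have h2 : Real.exp u - 1 ≠ 0 := by
    intro h; apply hu; have := Real.exp_eq_one_iff u |>.1 (by linarith); exact this
  have h3 : 1 - Real.exp (-u) ≠ 0 := by
    intro h; apply hu
    have : Real.exp (-u) = 1 := by linarith
    have := Real.exp_eq_one_iff (-u) |>.1 this; linarith
  rw [div_eq_div_iff h3 h2]
  have e1 : Real.exp (-((κ - 1) * u)) = Real.exp (-(κ * u)) * Real.exp u := by
    rw [← Real.exp_add]; ring_nf
  have e2 : Real.exp (-u) * Real.exp u = 1 := by rw [← Real.exp_add]; simp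
  rw [e1]
  linear_combination Real.exp (-(κ * u)) * e2

/-- **Lemma X (x-space form of the shifted archimedean term).** For a test function `h` and
`κ > 0`, with `K = h + h(−·)`:
`∫ ĥ(1/2+iy)·2 Re ψ(κ+iy) dy = 2π·[ψ(κ)·K(0) + ∫₀^∞ (K(0) − K(u)) e^{−κu}/(1 − e^{−u}) du]`,
i.e. `(1/π) ∫ ĥ(½+it) Re ψ(κ+it) dt = 2ψ(κ) h(0) + ∫₀^∞ (2h(0) − h(u) − h(−u)) e^{−(κ−1)u}/(e^u − 1) du`
(`K(0) = 2h(0)`). For `κ = k/2` this is the archimedean term of `weilQuadraticGL2`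
(`WeilExplicitGL2.lean`) in position space. [cite: Bombieri2000Weil, §2 eq. (2.8) (shifted: Gamma factor Γ(s + κ − 1/2))] -/
theorem integral_weilMellin_mul_two_re_digamma_shift_eq (hh : IsWeilTest h) {κ : ℝ} (hκ : 0 < κ) :
    (∫ y : ℝ, weilMellin h (((1 / 2 : ℝ) : ℂ) + y * I) * (2 * ((digamma ((κ : ℂ) + y * I)).re : ℂ))) =
      2 * π * (digamma (κ : ℂ) * weilSymm h 0 +
        ∫ u in Ioi (0 : ℝ), (weilSymm h 0 - weilSymm h u) *
          (cexp (-((κ : ℂ) * u)) / (1 - cexp (-(u : ℂ))))) := by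
  have hK : IsWeilTest (weilSymm h) := hh.weilSymm
  rw [integral_weilMellin_mul_two_re_digamma_shift hh hκ]
  set A : ℂ := ∫ y : ℝ, weilMellin (weilSymm h) (((1 / 2 : ℝ) : ℂ) + y * I) * digamma ((κ : ℂ) + y * I)
  set K0 : ℂ := weilSymm h 0
  set X : ℂ := ∫ u in Ioi (0 : ℝ), (K0 - weilSymm h u) * (cexp (-((κ : ℂ) * u)) / (1 - cexp (-(u : ℂ))))
  set J : ℕ → ℂ := fun n ↦ ∫ x in Ioi (0 : ℝ), weilSymm h x * cexp (-(((n : ℂ) + κ) * x))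
  -- (ii)+(iii): Σ (2πK0/(n+1) − 2π J n) = A + 2πγ K0
  have hC := hasSum_archIntegral_shift hK hκ
  -- (iv): Σ (K0/(n+κ) − J n) = X
  have hD : HasSum (fun n : ℕ ↦ K0 / ((n : ℂ) + κ) - J n) X := by
    have h := hasSum_integral_xTerms hK hκ
    simp_rw [integral_xTerm hK hκ] at h
    exact h
  -- (v): Σ (1/(n+1) − 1/(κ+n)) = ψ(κ) + γ
  have hE := Literature.Analysis.SpecialFunctions.Complex.hasSum_one_div_sub_one_div_digamma
    (w := (κ : ℂ)) (by simpa using hκ)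
  -- combine: termwise `2πK0/(n+1) − 2πJ n = 2π[(K0/(n+κ) − J n) + K0 (1/(n+1) − 1/(κ+n))]`
  have hcomb : HasSum (fun n : ℕ ↦ 2 * π * K0 / ((n : ℂ) + 1) - 2 * π * J n)
      (2 * π * (X + K0 * (digamma (κ : ℂ) + Real.eulerMascheroniConstant))) := by
    have h2 := (hD.add (hE.mul_left K0)).mul_left (2 * π : ℂ)
    refine h2.congr_fun fun n ↦ ?_
    have hne1 : (n : ℂ) + 1 ≠ 0 := by
      have : ((n + 1 : ℕ) : ℂ) ≠ 0 := Nat.cast_ne_zero.2 (Nat.succ_ne_zero n)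
      simpa using this
    have hne2 : (n : ℂ) + κ ≠ 0 := by
      intro h0; have := congrArg Complex.re h0; simp at this
      have hn : (0 : ℝ) ≤ n := n.cast_nonneg; linarith
    have hne3 : (κ : ℂ) + n ≠ 0 := by rw [add_comm]; exact hne2
    field_simp
    ring
  have huniq := hC.unique hcomb
  -- solve for `A`
  have : A = 2 * π * (digamma (κ : ℂ) * K0 + X) := by
    linear_combination huniq
  rw [this]

/-! ### Corollary: the weight-`k` Weil functional `Q_f` in position space -/

/-- **`Q_f` in position space** (prime-free window). For `k ≥ 1`, `Λf(0) = Λf(1) = 0`, a test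
function `g` supported in `[−a, a]` with `2a ≤ log 2`, `h = g ⋆ g̃` and `K = h + h(−·)`:
`Re Q_f(g) = ‖g‖₂²·(log N − 2 log 2π) + Re(ψ(k/2)·K(0) + ∫₀^∞ (K(0) − K(u)) e^{−(k/2)u}/(1 − e^{−u}) du)`
(`K(0) = 2‖g‖₂²`; `e^{−(k/2)u}/(1−e^{−u}) = e^{−(k/2−1)u}/(e^u−1)`): the archimedean term of
`weilQuadraticGL2` ((Q-GL2), arXiv:1412.2990 Prop. 2.1) in the x-space form in which the GL₂ window
certificates are computed. [cite: Bombieri2000Weil, §2 eq. (2.8) (shifted Gamma factor; with IwaniecKowalski2004 (5.86))] -/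
theorem re_weilQuadraticGL2_eq_xSpace {k N : ℕ} {Λf : ℕ → ℂ} (hk : 1 ≤ k) (h0 : Λf 0 = 0)
    (h1 : Λf 1 = 0) {g : ℝ → ℂ} (hg : IsWeilTest g) {a : ℝ} (hsupp : tsupport g ⊆ Icc (-a) a)
    (ha : 2 * a ≤ Real.log 2) :
    (weilQuadraticGL2 k N Λf g).re =
      (∫ t : ℝ, ‖g t‖ ^ 2) * (Real.log N - 2 * Real.log (2 * π)) +
        (digamma ((k : ℂ) / 2) * weilSymm (weilConv g (weilReflect g)) 0 +
          ∫ u in Ioi (0 : ℝ), (weilSymm (weilConv g (weilReflect g)) 0 -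
              weilSymm (weilConv g (weilReflect g)) u) *
            (cexp (-((k : ℂ) / 2 * u)) / (1 - cexp (-(u : ℂ))))).re := by
  rw [re_weilQuadraticGL2_of_tsupport_subset h0 h1 hg hsupp ha]
  congr 1
  have hk0 : (0 : ℝ) < k := by exact_mod_cast hk
  have hκ : (0 : ℝ) < (k : ℝ) / 2 := by positivity
  have hX := integral_weilMellin_mul_two_re_digamma_shift_eq (hg.weilConv hg.weilReflect) hκ
  have hc1 : ((((k : ℝ) / 2 : ℝ)) : ℂ) = (k : ℂ) / 2 := by push_cast; ring
  have hc2 : (((1 / 2 : ℝ)) : ℂ) = 1 / 2 := by push_cast; ring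
  simp only [hc1, hc2] at hX
  set Z : ℂ := digamma ((k : ℂ) / 2) * weilSymm (weilConv g (weilReflect g)) 0 +
    ∫ u in Ioi (0 : ℝ), (weilSymm (weilConv g (weilReflect g)) 0 -
      weilSymm (weilConv g (weilReflect g)) u) * (cexp (-((k : ℂ) / 2 * u)) / (1 - cexp (-(u : ℂ))))
  have hL : (∫ y : ℝ, weilMellin (weilConv g (weilReflect g)) (1 / 2 + y * I) *
      (2 * ((digamma ((k : ℂ) / 2 + y * I)).re : ℂ))) =
      ((∫ t : ℝ, 2 * (‖weilMellin g (1 / 2 + t * I)‖ ^ 2 *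
        (digamma ((k : ℂ) / 2 + t * I)).re) : ℝ) : ℂ) := by
    rw [← integral_complex_ofReal]
    congr 1 with t
    rw [weilMellin_weilConv_weilReflect_half hg]
    push_cast; ring
  have hre := congrArg Complex.re hX
  rw [hL, Complex.ofReal_re, integral_const_mul,
    show (2 * π * Z : ℂ) = ((2 * π : ℝ) : ℂ) * Z by push_cast; ring, Complex.re_ofReal_mul] at hre
  have hI : (∫ t : ℝ, ‖weilMellin g (1 / 2 + t * I)‖ ^ 2 * (digamma ((k : ℂ) / 2 + t * I)).re) =
      π * Z.re := by nlinarith [hre, Real.pi_pos]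
  rw [hI]
  field_simp

end Literature.NumberTheory.LFunctions

end
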